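import Summits.BirchSwinnertonDyer.BirchSwinnertonDyer.Theorems.CyclotomicUntwistPSUntwistedTraceInvariance
import HarnessLib

/-!
# Rizzo's Table II readings (`rootNumberThree`, `tableKodairaSymbolThree`, `tableConductorExponentThree`) do NOT
# depend on the Weierstrass equation — the «any equation may be used» clause of `RootNumberTableThree`, proved
# (route `CyclotomicUntwist`, LAW L-w3 / D4 sign `η(−1) = W₃`; cruxes K1 `PSRankOneLowerHalfAtThree` / K2)

Cell `pub/bsd-wall` (D-0145 line `route-BirchSwinnertonDyer-CyclotomicUntwist`), seat `bsd-line-cycu-p3` (gen 6).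
Helper toward K1 (stmt-BirchSwinnertonDyer-21580) / K2 (stmt-21581): the route reads the sign of its pinned analytic
constant `κ = 9η(−1)/α²` as `η(−1) = W₃(E) := W.rootNumberThree` (LAW L-w3, `PSRootNumberThree`; parity file p608398),
a TABLE READING on the invariants of the chosen equation. THEOREMS ONLY (no definition, no named fact, no `sorry`);
BSD is not proved by this file and no crux is.

WHAT. `Literature/NumberTheory/EllipticCurves/RootNumberTableThree.lean` defines `Rizzo.ofInvariants c₄ c₆ Δ` (shift
`m = min ⌊v₃c₄/4⌋ ⌊v₃c₆/6⌋ ⌊v₃Δ/12⌋`, reduced triple, residues `res9`) and `W.rootNumberThree := (ofInvariants W.c₄ W.c₆ W.Δ).2.2`,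
and states IN PROSE (§1.2) that any equation of the curve may be used («a rescaling `u = 3ᵏu₀` shifts the valuations by
`k·(4,6,12)` and multiplies `c₄', c₆', Δ'` by `u₀⁻⁴ ≡ 1 (3)`, `u₀⁻⁶ ≡ 1 (9)`, `u₀⁻¹² ≡ 1 (9)`»). The tree's NAMED FACT
`WeierstrassCurve.rootNumber_eq_neg_finprod_fullTableLocalRootNumberAt` is stated for EVERY equation `W`, so a
model-DEPENDENT table reading would make that fact inconsistent; this file removes the worry at `3` by proving the
prose claim:

* §1 `three_mul_c4e_emod_nine_congr`, **`tableII_congr_c4`** — the 24-row table depends on `c₄'` only modulo `3`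
  (the conditions read `c₄' % 3` and `3·c_{4,e} mod 9`); `shift_add` — the shift absorbs a common `k·(12,6,4)`;
  `val3_pow_mul`; `pow_mul_eq_div`; **`res9_pow_four_mul_emod_three`** (`res9 (u⁴x) ≡ res9 x (mod 3)`; with
  `res9_pow_six_mul` / `res9_pow_twelve_mul` of `CyclotomicUntwistPSUntwistedTraceInvariance` for `c₆`, `Δ`);
* §2 **`ofInvariants_rescale`**: `ofInvariants (u⁴c₄) (u⁶c₆) (u¹²Δ) = ofInvariants c₄ c₆ Δ` (`u ≠ 0`, `Δ ≠ 0`);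
* §3 **`rootNumberThree_variableChange`**, `tableKodairaSymbolThree_variableChange`,
  `tableConductorExponentThree_variableChange`: `(C • W).… = W.…` for every `C : VariableChange ℚ`, `Δ(W) ≠ 0`
  (and the `IsElliptic` forms).

References: O. G. Rizzo, Compositio Math. 136 (2003) 1–23, §1.1–1.2 and Table II [Rizzo2003]; L. C. Kellock,
V. Dokchitser, *Root numbers and parity phenomena*, Bull. LMS 55 (2023), Notation 5.1 [KellockDokchitser2023];
J. H. Silverman, *AEC* III.1 Table 3.1 [SilvermanAEC2009].
-/

set_option autoImplicit false
-- single-conjunct summit: `Summit.BirchSwinnertonDyer.BirchSwinnertonDyer.…` repeats the name by design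
set_option linter.dupNamespace false

open Literature.NumberTheory.EllipticCurves Summit.BirchSwinnertonDyer.Rank1Residual.GaloisImage
  Summit.BirchSwinnertonDyer.BirchSwinnertonDyer.Theorems.PSUntwistedTrace

namespace Summit.BirchSwinnertonDyer.BirchSwinnertonDyer.Theorems.RizzoTableInvariance

/-! ### §1 The table's residue dependence, the shift, the valuations -/

section Pieces

/-- `3·c_{4,e} mod 9` depends on `c₄'` only modulo `3` (`c_{4,e} = c₄'·3^{a−e}`: for `a = e` it is `3c₄' mod 9`, for
`a > e` it is `0`). [cite: Rizzo2003, p. 2 (notation c_{n,e}) and Table II] -/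
theorem three_mul_c4e_emod_nine_congr (a : WithTop ℤ) (e : ℕ) {x x' : ℤ} (h : x % 3 = x' % 3) :
    (3 * Rizzo.c4e a x e) % 9 = (3 * Rizzo.c4e a x' e) % 9 := by
  unfold Rizzo.c4e
  cases a with
  | top => rfl
  | coe n =>
    dsimp only
    rcases Nat.eq_zero_or_pos (n - e).toNat with h0 | hpos
    · rw [h0, pow_zero, mul_one, mul_one]; omega
    · obtain ⟨k, hk⟩ := Nat.exists_eq_succ_of_ne_zero hpos.ne'
      rw [hk, pow_succ]
      have e1 : 3 * (x * (3 ^ k * 3)) = 9 * (x * 3 ^ k) := by ring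
      have e2 : 3 * (x' * (3 ^ k * 3)) = 9 * (x' * 3 ^ k) := by ring
      rw [e1, e2, Int.mul_emod_right, Int.mul_emod_right]

/-- **Table II depends on `c₄'` only modulo `3`** (all 24 rows: the special conditions read `c₄' mod 3` on rows
`(2,4,3)`, `(3,5,6)` and `3c_{4,e} mod 9` on rows `(≥2,3,3)`, `(≥4,6,9)`, `(4,6,9)`). [cite: Rizzo2003, Table II (p. 4)] -/
theorem tableII_congr_c4 (a b : WithTop ℤ) (c : ℤ) {x x' : ℤ} (y z : ℤ) (h : x % 3 = x' % 3) :
    Rizzo.tableII a b c x y z = Rizzo.tableII a b c x' y z := by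
  have h2 := three_mul_c4e_emod_nine_congr a 2 h
  have h4 := three_mul_c4e_emod_nine_congr a 4 h
  unfold Rizzo.tableII
  simp only [h, h2, h4]

/-- **The shift absorbs a common multiple of `(12, 6, 4)`**: `shift (vΔ + 12t) (v₆ + 6t) (v₄ + 4t) = shift vΔ v₆ v₄ + t`.
[cite: KellockDokchitser2023, Notation 5.1] [cite: Rizzo2003, §1.1–1.2] -/
theorem shift_add (vΔ : ℤ) (v6 v4 : WithTop ℤ) (t : ℤ) :
    KellockDokchitser.shift (vΔ + 12 * t) (v6.map fun n => n + 6 * t) (v4.map fun n => n + 4 * t) =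
      KellockDokchitser.shift vΔ v6 v4 + t := by
  unfold KellockDokchitser.shift
  have hΔ : (vΔ + 12 * t) / 12 = vΔ / 12 + t := by omega
  cases v6 with
  | top =>
    cases v4 with
    | top => simp [hΔ]
    | coe n4 =>
      simp only [WithTop.map_top, WithTop.map_coe, hΔ]
      have : (n4 + 4 * t) / 4 = n4 / 4 + t := by omega
      rw [this, min_add_add_right]
  | coe n6 =>
    have h6 : (n6 + 6 * t) / 6 = n6 / 6 + t := by omega
    cases v4 with
    | top => simp only [WithTop.map_top, WithTop.map_coe, hΔ, h6, min_add_add_right]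
    | coe n4 =>
      simp only [WithTop.map_coe, hΔ, h6]
      have : (n4 + 4 * t) / 4 = n4 / 4 + t := by omega
      rw [this, min_add_add_right, min_add_add_right]

/-- `val3 (uᵏ·x) = val3 x + k·v₃(u)` (in `WithTop ℤ`; `⊤ + _ = ⊤` for `x = 0`). [cite: Rizzo2003, §1.1 (p. 3)] -/
theorem val3_pow_mul {u x : ℚ} (hu : u ≠ 0) (k : ℕ) :
    Rizzo.val3 (u ^ k * x) = (Rizzo.val3 x).map fun n => n + k * padicValRat 3 u := by
  unfold Rizzo.val3
  by_cases hx : x = 0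
  · simp [hx]
  · have hux : u ^ k * x ≠ 0 := mul_ne_zero (pow_ne_zero _ hu) hx
    simp only [hux, hx, if_false, WithTop.map_coe]
    rw [padicValRat.mul (pow_ne_zero _ hu) hx, padicValRat.pow]
    push_cast
    exact add_comm _ _

/-- `Pᵏ·Q = (num Pᵏ · num Q) / (den Pᵏ · den Q)`. [folklore] -/
theorem pow_mul_eq_div (P Q : ℚ) (k : ℕ) :
    P ^ k * Q = (((P.num ^ k * Q.num : ℤ)) : ℚ) / (((P.den ^ k * Q.den : ℕ)) : ℚ) := by
  have hP : (P.den : ℚ) ≠ 0 := by exact_mod_cast P.den_nz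
  have hQ : (Q.den : ℚ) ≠ 0 := by exact_mod_cast Q.den_nz
  conv_lhs => rw [← Rat.num_div_den P, ← Rat.num_div_den Q]
  push_cast
  rw [div_pow]
  field_simp

/-- Fourth powers of units of `ℤ/3` are `1`. [folklore] -/
theorem pow_four_eq_one_zmod_three : ∀ z : ZMod 3, z ≠ 0 → z ^ 4 = 1 := by decide

/-- **`res9 (u⁴·x) ≡ res9 x (mod 3)`** for `u ≠ 0`: the prime-to-`3` part gets multiplied by `(u′)⁴`, a fourth power
of a unit, `≡ 1 (mod 3)` (not mod `9` — which is why Table II reads `c₄'` only modulo `3`).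
[cite: Rizzo2003, §1.2 (any equation)] -/
theorem res9_pow_four_mul_emod_three {u : ℚ} (hu : u ≠ 0) (x : ℚ) :
    Rizzo.res9 (u ^ 4 * x) % 3 = Rizzo.res9 x % 3 := by
  by_cases hx : x = 0
  · subst hx; simp
  set P := Rizzo.primeToThreePart u with hPdef
  set Q := Rizzo.primeToThreePart x with hQdef
  have hP0 : P ≠ 0 := primeToThreePart_ne_zero hu
  have hQ0 : Q ≠ 0 := primeToThreePart_ne_zero hx
  obtain ⟨hPn, hPd⟩ := not_dvd_num_den_of_padicValRat_eq_zero hP0 (padicValRat_primeToThreePart hu)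
  obtain ⟨-, hQd⟩ := not_dvd_num_den_of_padicValRat_eq_zero hQ0 (padicValRat_primeToThreePart hx)
  have hR : Rizzo.primeToThreePart (u ^ 4 * x) = P ^ 4 * Q := by
    rw [primeToThreePart_mul (pow_ne_zero _ hu) hx, primeToThreePart_pow hu]
  have hn : ¬ 3 ∣ P.den ^ 4 * Q.den := by
    intro h
    rcases (Nat.Prime.dvd_mul Nat.prime_three).mp h with h | h
    · exact hPd (Nat.prime_three.dvd_of_dvd_pow h)
    · exact hQd h
  -- in `ℤ/9`: `res9 (u⁴x) = (num P)⁴ (num Q) · ((den P)⁴ den Q)⁻¹`, `res9 x = num Q · (den Q)⁻¹`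
  have h9a : ((Rizzo.res9 (u ^ 4 * x) : ℤ) : ZMod 9) =
      ((P.num ^ 4 * Q.num : ℤ) : ZMod 9) * (((P.den ^ 4 * Q.den : ℕ) : ZMod 9))⁻¹ := by
    rw [res9_cast, cast_num_mul_inv_den_eq_of_eq_div hn (hR.trans (pow_mul_eq_div P Q 4))]
  have h9b : ((Rizzo.res9 x : ℤ) : ZMod 9) = (Q.num : ZMod 9) * ((Q.den : ZMod 9))⁻¹ := res9_cast x
  -- clear the (unit) denominators: `res9(u⁴x) · (den P)⁴ den Q = num P⁴ num Q`, `res9 x · den Q = num Q`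
  have hN := natCast_mul_inv_eq_one hn
  have hD := natCast_mul_inv_eq_one hQd
  have eqa : ((Rizzo.res9 (u ^ 4 * x) : ℤ) : ZMod 9) * (((P.den ^ 4 * Q.den : ℕ) : ZMod 9)) =
      ((P.num ^ 4 * Q.num : ℤ) : ZMod 9) := by
    rw [h9a]; linear_combination ((P.num ^ 4 * Q.num : ℤ) : ZMod 9) * hN
  have eqb : ((Rizzo.res9 x : ℤ) : ZMod 9) * ((Q.den : ZMod 9)) = (Q.num : ZMod 9) := by
    rw [h9b]; linear_combination (Q.num : ZMod 9) * hD
  -- descend to `ℤ/3`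
  have eqa3 := congrArg (ZMod.castHom (show 3 ∣ 9 by norm_num) (ZMod 3)) eqa
  have eqb3 := congrArg (ZMod.castHom (show 3 ∣ 9 by norm_num) (ZMod 3)) eqb
  simp only [map_mul, map_pow, map_intCast, map_natCast, Int.cast_mul, Int.cast_pow, Nat.cast_mul, Nat.cast_pow] at eqa3 eqb3
  have hPn3 : ((P.num : ZMod 3)) ^ 4 = 1 :=
    pow_four_eq_one_zmod_three _ (by rw [Ne, ZMod.intCast_zmod_eq_zero_iff_dvd]; exact_mod_cast hPn)
  have hPd3 : ((P.den : ZMod 3)) ^ 4 = 1 :=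
    pow_four_eq_one_zmod_three _ (by rw [Ne, ZMod.natCast_eq_zero_iff]; exact_mod_cast hPd)
  have hQd3 : ((Q.den : ZMod 3)) ≠ 0 := by rw [Ne, ZMod.natCast_eq_zero_iff]; exact_mod_cast hQd
  rw [hPn3, one_mul] at eqa3
  rw [hPd3, one_mul] at eqa3
  -- both residues times `den Q` equal `num Q` in the field `ℤ/3`
  have key : ((Rizzo.res9 (u ^ 4 * x) : ℤ) : ZMod 3) = ((Rizzo.res9 x : ℤ) : ZMod 3) :=
    mul_right_cancel₀ hQd3 (eqa3.trans eqb3.symm)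
  have := (ZMod.intCast_eq_intCast_iff _ _ 3).mp key
  exact this

end Pieces

/-! ### §2 `ofInvariants` is invariant under `(c₄, c₆, Δ) ↦ (u⁴c₄, u⁶c₆, u¹²Δ)` -/

section OfInvariants

/-- Reduced valuations are unchanged: `(v + k t) − k (m + t) = v − k m` under `WithTop.map`. [folklore] -/
theorem map_add_map_sub (v : WithTop ℤ) (k t m : ℤ) :
    ((v.map fun n => n + k * t).map fun n => n - k * (m + t)) = v.map fun n => n - k * m := by
  cases v with
  | top => rfl
  | coe n =>
    simp only [WithTop.map_coe]
    congr 1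
    ring

/-- **`ofInvariants (u⁴c₄) (u⁶c₆) (u¹²Δ) = ofInvariants c₄ c₆ Δ`** for `u ≠ 0`, `Δ ≠ 0`: the shift absorbs
`v₃(u)·(4, 6, 12)`, the reduced triple is unchanged, `res9` of `c₆` and `Δ` is unchanged and `res9 c₄` changes only
modulo `9` but not modulo `3`, which is all the table reads. [cite: Rizzo2003, §1.1–1.2 (pp. 3–4)] -/
theorem ofInvariants_rescale {u : ℚ} (hu : u ≠ 0) (c₄ c₆ : ℚ) {Δ : ℚ} (hΔ : Δ ≠ 0) :
    Rizzo.ofInvariants (u ^ 4 * c₄) (u ^ 6 * c₆) (u ^ 12 * Δ) = Rizzo.ofInvariants c₄ c₆ Δ := by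
  unfold Rizzo.ofInvariants
  dsimp only
  set t := padicValRat 3 u with ht
  have hvΔ : padicValRat 3 (u ^ 12 * Δ) = padicValRat 3 Δ + 12 * t := by
    rw [padicValRat.mul (pow_ne_zero _ hu) hΔ, padicValRat.pow]; push_cast; ring
  have hv6 : Rizzo.val3 (u ^ 6 * c₆) = (Rizzo.val3 c₆).map fun n => n + 6 * t := by
    rw [val3_pow_mul hu 6]; rfl
  have hv4 : Rizzo.val3 (u ^ 4 * c₄) = (Rizzo.val3 c₄).map fun n => n + 4 * t := by
    rw [val3_pow_mul hu 4]; rfl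
  rw [hvΔ, hv6, hv4, shift_add]
  set m := KellockDokchitser.shift (padicValRat 3 Δ) (Rizzo.val3 c₆) (Rizzo.val3 c₄) with hm
  rw [map_add_map_sub, map_add_map_sub,
    show padicValRat 3 Δ + 12 * t - 12 * (m + t) = padicValRat 3 Δ - 12 * m by ring,
    res9_pow_six_mul hu, res9_pow_twelve_mul hu]
  exact tableII_congr_c4 _ _ _ _ _ (res9_pow_four_mul_emod_three hu c₄)

end OfInvariants

/-! ### §3 The curve-level readings are equation-independent -/

section Curve

variable (C : WeierstrassCurve.VariableChange ℚ) (W : WeierstrassCurve ℚ)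

/-- **`W.rootNumberThree` does not depend on the equation**: `(C • W).rootNumberThree = W.rootNumberThree` for every
change of variables `C` over `ℚ` and every `W` with `Δ ≠ 0` — Rizzo §1.2's «any equation may be used», as a theorem.
[cite: Rizzo2003, §1.2 (p. 4) and Table II] [cite: SilvermanAEC2009, III.1 Table 3.1] -/
theorem rootNumberThree_variableChange (hΔ : W.Δ ≠ 0) : (C • W).rootNumberThree = W.rootNumberThree := by
  rw [WeierstrassCurve.rootNumberThree_def, WeierstrassCurve.rootNumberThree_def, Rizzo.w3OfInvariants,
    Rizzo.w3OfInvariants, WeierstrassCurve.variableChange_c₄, WeierstrassCurve.variableChange_c₆,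
    WeierstrassCurve.variableChange_Δ, ofInvariants_rescale (Units.ne_zero _) _ _ hΔ]

/-- `W.tableKodairaSymbolThree` does not depend on the equation (`Δ ≠ 0`). [cite: Rizzo2003, §1.2 and Table II, column Kod] -/
theorem tableKodairaSymbolThree_variableChange (hΔ : W.Δ ≠ 0) :
    (C • W).tableKodairaSymbolThree = W.tableKodairaSymbolThree := by
  unfold WeierstrassCurve.tableKodairaSymbolThree Rizzo.kodairaOfInvariants
  rw [WeierstrassCurve.variableChange_c₄, WeierstrassCurve.variableChange_c₆, WeierstrassCurve.variableChange_Δ,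
    ofInvariants_rescale (Units.ne_zero _) _ _ hΔ]

/-- `W.tableConductorExponentThree` does not depend on the equation (`Δ ≠ 0`).
[cite: Rizzo2003, §1.2 and Table II, column v(N)] -/
theorem tableConductorExponentThree_variableChange (hΔ : W.Δ ≠ 0) :
    (C • W).tableConductorExponentThree = W.tableConductorExponentThree := by
  rw [WeierstrassCurve.tableConductorExponentThree_def, WeierstrassCurve.tableConductorExponentThree_def,
    Rizzo.condExpOfInvariants, Rizzo.condExpOfInvariants, WeierstrassCurve.variableChange_c₄,
    WeierstrassCurve.variableChange_c₆, WeierstrassCurve.variableChange_Δ, ofInvariants_rescale (Units.ne_zero _) _ _ hΔ]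

/-- The elliptic-curve form of `rootNumberThree_variableChange`. [cite: Rizzo2003, §1.2 (p. 4)] -/
theorem rootNumberThree_variableChange_of_isElliptic [W.IsElliptic] :
    (C • W).rootNumberThree = W.rootNumberThree :=
  rootNumberThree_variableChange C W W.isUnit_Δ.ne_zero

end Curve

end Summit.BirchSwinnertonDyer.BirchSwinnertonDyer.Theorems.RizzoTableInvariance
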